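import Literature.NumberTheory.GaloisRepresentations.LubinTateColemanRelativeCoordGaloisTwo
import Literature.NumberTheory.GaloisRepresentations.LocalFrobeniusDensity
import HarnessLib

/-!
# The action of ALL of `Γ_F` on `𝒰(E·K_π^∞)` at `q = 2`: `g_{σ̃β} = g_β^{σ̃|E} ∘ [χ(σ̃)]`, `δ(σ̃β) = χ·(δβ)^{σ̃|E} ∘ [χ]`,
# `r_{σ̃β} = χ·ρ_χ·(r_β^{σ̃|E} ∘ [χ])` (de Shalit I §3.4: extension of `i` from `G` to `𝒢 = Gal(k_ξ/k)`)

De Shalit, *Iwasawa theory of elliptic curves with complex multiplication* (1987), Ch. I §2.3 (iv) and §3.4 (the paragraph after the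
Lemma: "`𝒢/G = Gal(k'/k)` … we can now extend `μ_β` to a measure on `𝒢`"): for `σ̃ ∈ Γ_F` NOT necessarily fixing the unramified base
`E = k'`, the Coleman series of `σ̃β` is `g_β` with its COEFFICIENTS moved by `σ̃|_E` and its variable by `[χ_π(σ̃)]_f`.  The tree's
`relColemanSeries_galAct` / `relUnitCoordTwo_galAct` (`σ̃|_E = id`) are the special case.  Key input: on a finite `E ⊆ F^{nr}` every
`σ̃` acts as a power of the arithmetic Frobenius (`LocalFrobeniusDensity`), so `σ̃|_E` commutes with `φ`.

* `exists_forall_frobUnitBall_eq_pow` — **`σ̃|_{𝒪_E} = φ^a` for some `a ∈ ℕ`** (`E ⊆ F(μ_M) ⊆ F^{nr}`);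
* `map_frobUnitBall_comm_iterate_symm` / `map_frobUnitBall_comm` — `σ̃|_E` commutes with `φ^{±1}` on `𝒪_E⟦X⟧`;
* ★★ `relColemanSeries_galAct_eq` — **`g_{σ̃β} = (g_β)^{σ̃|E} ∘ [χ_π(σ̃)]_f`** for every `σ̃ ∈ Γ_F` (Cor. 2.3 (iv) + Lemma 3.4 (iii));
* ★ `relLogDerivSeries_galAct_eq` — `δ(σ̃β) = χ_π(σ̃)·((δβ)^{σ̃|E} ∘ [χ_π(σ̃)])`;
* ★★ `relUnitCoordTwo_galAct_eq` — **`r_{σ̃β} = χ_π(σ̃)·ι ρ_{χ_π(σ̃)}·((r_β)^{σ̃|E} ∘ [χ_π(σ̃)]_f)`**: the semilinear action of the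
  whole `Gal(E·K_π^∞/F)` on the coordinate module `𝒪_E⟦Y⟧` (through `σ̃ ↦ (σ̃|_E, χ_π(σ̃))`) for which `β ↦ r_β` is equivariant.

Everything PROVED (0 sorry).

## References

* E. de Shalit, *Iwasawa theory of elliptic curves with complex multiplication* (1987), Ch. I §2.3 (iv), §3.4 Lemma (ii)–(iii) and the
  extension to `𝒢`, §3.7. [deShalit1987]
* J.-P. Serre, *Local Fields* (1979), Ch. IV §4. [SerreLocalFields1979]
-/

noncomputable section

open scoped PowerSeries.WithPiTopology

namespace Literature.NumberTheory.GaloisRepresentations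

section RelativeGaloisGeneralTwo

open GaloisRepresentations.IsNonarchimedeanLocalField LubinTate ValuativeRel Field

variable {F : Type} [Field F] [ValuativeRel F] [TopologicalSpace F] [IsNonarchimedeanLocalField F]

attribute [local instance] ltNormUniformSpace ltNormIsUniformAddGroup rk1 nF nE fintypeResidueField

variable {π : 𝒪[F]} (hπ : (valuation F).IsUniformizer (π : F))
variable (E : IntermediateField F (AlgebraicClosure F)) [FiniteDimensional F E] [Normal F E]

/-! ### On a finite unramified `E` every `σ̃ ∈ Γ_F` is a power of the Frobenius -/

omit [Normal F E] in
/-- **`σ̃|_E = σ₀^a|_E` for some `a ∈ ℕ`** when `E ⊆ F^{nr}` is finite over `F` and `σ₀` is an arithmetic Frobenius (`E` lies in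
some `F(μ_M)`, `p ∤ M`, on which `σ̃` agrees with a power of `σ₀`). [cite: SerreLocalFields1979, Ch. IV §4 Prop. 16] -/
theorem exists_forall_smul_eq_pow_smul (hE : E ≤ maxUnramified F) {σ₀ : absoluteGaloisGroup F} (hσ₀ : IsAbsArithFrob σ₀)
    (σ : absoluteGaloisGroup F) : ∃ a : ℕ, ∀ x : E, σ • (x : AlgebraicClosure F) = (σ₀ ^ a) • (x : AlgebraicClosure F) := by
  classical
  obtain ⟨b⟩ : Nonempty (Module.Basis (Fin (Module.finrank F E)) F E) := ⟨Module.finBasis F E⟩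
  obtain ⟨M, hM, hT⟩ := exists_subset_adjoin_rootsOfUnity (F := F) (Finset.univ.image fun i => (b i : AlgebraicClosure F))
    (fun t ht => by
      obtain ⟨i, -, rfl⟩ := Finset.mem_image.mp ht
      exact hE (b i).2)
  obtain ⟨a, ha⟩ := exists_forall_mem_adjoin_rootsOfUnity_smul_eq hσ₀ σ hM
  refine ⟨a, fun x => ha _ ?_⟩
  -- `x = Σ c_i b_i` lies in `F(μ_M)`
  have hx : (x : AlgebraicClosure F) = ∑ i, b.repr x i • (b i : AlgebraicClosure F) := by
    conv_lhs => rw [← b.sum_repr x]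
    rw [IntermediateField.coe_sum]
    refine Finset.sum_congr rfl fun i _ => ?_
    rw [IntermediateField.coe_smul]
  rw [hx]
  refine Subalgebra.sum_mem _ fun i _ => Subalgebra.smul_mem _ (hT _ (Finset.mem_image.mpr ⟨i, Finset.mem_univ i, rfl⟩)) _

/-- ★ **`σ̃|_{𝒪_E} = φ^a`**: the restriction of any `σ̃ ∈ Γ_F` to `𝒪_E` (`E ⊆ F^{nr}` finite normal) is a power of the Frobenius
`φ = σ₀|_{𝒪_E}`. [cite: SerreLocalFields1979, Ch. IV §4 Prop. 16] -/
theorem exists_forall_frobUnitBall_eq_pow (hE : E ≤ maxUnramified F) {σ₀ : absoluteGaloisGroup F} (hσ₀ : IsAbsArithFrob σ₀)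
    (σ : absoluteGaloisGroup F) :
    ∃ a : ℕ, ∀ c : unitBall E, (frobUnitBall E σ : unitBall E →+* unitBall E) c = ((frobUnitBall E σ₀ : unitBall E →+* unitBall E) ^ a) c := by
  obtain ⟨a, ha⟩ := exists_forall_smul_eq_pow_smul E hE hσ₀ σ
  refine ⟨a, fun c => ?_⟩
  apply Subtype.ext; apply Subtype.ext
  have e1 : ((((frobUnitBall E σ : unitBall E →+* unitBall E) c : unitBall E) : E) : AlgebraicClosure F) =
      σ • ((c : E) : AlgebraicClosure F) := coe_restrictNormal_apply E σ (c : E)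
  rw [e1, ha c]
  clear ha e1
  induction a with
  | zero => rw [pow_zero, one_smul, pow_zero, RingHom.one_def, RingHom.id_apply]
  | succ a ih =>
    rw [pow_succ' σ₀, mul_smul, ih, pow_succ' (frobUnitBall E σ₀ : unitBall E →+* unitBall E), RingHom.mul_def, RingHom.comp_apply]
    exact (coe_restrictNormal_apply E σ₀ _).symm

/-- **`σ̃|_E` commutes with `φ⁻¹` (and its iterates) on `𝒪_E⟦X⟧.** [cite: deShalit1987, Ch. I §3.4] -/
theorem map_frobUnitBall_comm_iterate_symm (hE : E ≤ maxUnramified F) {σ₀ : absoluteGaloisGroup F} (hσ₀ : IsAbsArithFrob σ₀)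
    (σ : absoluteGaloisGroup F) (k : ℕ) (G : PowerSeries (unitBall E)) :
    PowerSeries.map (frobUnitBall E σ : unitBall E →+* unitBall E)
        ((PowerSeries.map ((frobUnitBall E σ₀).symm : unitBall E →+* unitBall E))^[k] G) =
      (PowerSeries.map ((frobUnitBall E σ₀).symm : unitBall E →+* unitBall E))^[k]
        (PowerSeries.map (frobUnitBall E σ : unitBall E →+* unitBall E) G) := by
  obtain ⟨a, ha⟩ := exists_forall_frobUnitBall_eq_pow E hE hσ₀ σ
  have hcomm : Function.Commute ((frobUnitBall E σ₀ : unitBall E →+* unitBall E) : unitBall E → unitBall E)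
      (((frobUnitBall E σ₀).symm : unitBall E →+* unitBall E) : unitBall E → unitBall E) := fun c => by
    change (frobUnitBall E σ₀) ((frobUnitBall E σ₀).symm c) = (frobUnitBall E σ₀).symm ((frobUnitBall E σ₀) c)
    rw [RingEquiv.apply_symm_apply, RingEquiv.symm_apply_apply]
  refine PowerSeries.ext fun n => ?_
  rw [PowerSeries.coeff_map, ← map_pow_eq_iterate, ← map_pow_eq_iterate, PowerSeries.coeff_map, PowerSeries.coeff_map,
    PowerSeries.coeff_map, ha, ha, RingHom.coe_pow, RingHom.coe_pow]
  exact (hcomm.iterate_iterate a k) _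

/-- **`σ̃|_E` commutes with `φ` on `𝒪_E⟦X⟧.** [cite: deShalit1987, Ch. I §3.4] -/
theorem map_frobUnitBall_comm (hE : E ≤ maxUnramified F) {σ₀ : absoluteGaloisGroup F} (hσ₀ : IsAbsArithFrob σ₀)
    (σ : absoluteGaloisGroup F) (G : PowerSeries (unitBall E)) :
    PowerSeries.map (frobUnitBall E σ : unitBall E →+* unitBall E) (PowerSeries.map (frobUnitBall E σ₀ : unitBall E →+* unitBall E) G) =
      PowerSeries.map (frobUnitBall E σ₀ : unitBall E →+* unitBall E) (PowerSeries.map (frobUnitBall E σ : unitBall E →+* unitBall E) G) := by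
  obtain ⟨a, ha⟩ := exists_forall_frobUnitBall_eq_pow E hE hσ₀ σ
  refine PowerSeries.ext fun n => ?_
  rw [PowerSeries.coeff_map, PowerSeries.coeff_map, PowerSeries.coeff_map, PowerSeries.coeff_map, ha, ha, RingHom.coe_pow,
    ← Function.iterate_succ_apply, Function.iterate_succ_apply']

omit [FiniteDimensional F E] in
/-- `σ̃|_{E·K_π^{m+1}}` restricted to `E` is `σ̃|_E`. [cite: deShalit1987, Ch. I §1.8] -/
theorem relRestrict_apply_inclusion_eq (σ : absoluteGaloisGroup F) (m : ℕ) (x : E) :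
    relRestrict hπ E m σ (IntermediateField.inclusion le_sup_left x) =
      IntermediateField.inclusion le_sup_left (((absoluteGaloisGroup.toAlgEquiv F σ).restrictNormal E) x) :=
  Subtype.ext (by rw [coe_relRestrict_apply, IntermediateField.coe_inclusion, IntermediateField.coe_inclusion, coe_restrictNormal_apply])

/-- Coefficientwise: `σ̃|_{E_m} ∘ ι = ι ∘ σ̃|_E` on `𝒪_E⟦X⟧`. [cite: deShalit1987, Ch. I §1.8] -/
theorem map_toUnitBallHom_relRestrict_map_inclUnitBall (σ : absoluteGaloisGroup F) (m : ℕ) (G : PowerSeries (unitBall E)) :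
    PowerSeries.map (toUnitBallHom (relRestrict hπ E m σ))
        (PowerSeries.map (inclUnitBall (F := F) (le_sup_left : E ≤ E ⊔ ltField π m) :
          unitBall E →+* unitBall (E ⊔ ltField π m : IntermediateField F (AlgebraicClosure F))) G) =
      PowerSeries.map (inclUnitBall (F := F) (le_sup_left : E ≤ E ⊔ ltField π m) :
          unitBall E →+* unitBall (E ⊔ ltField π m : IntermediateField F (AlgebraicClosure F)))
        (PowerSeries.map (frobUnitBall E σ : unitBall E →+* unitBall E) G) := by
  refine PowerSeries.ext fun n => ?_
  rw [PowerSeries.coeff_map, PowerSeries.coeff_map, PowerSeries.coeff_map, PowerSeries.coeff_map]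
  apply Subtype.ext
  exact relRestrict_apply_inclusion_eq hπ E σ m _

/-! ### `g_{σ̃β} = g_β^{σ̃|E} ∘ [χ(σ̃)]` -/

variable [IsGalois F E] (hq : residueFieldCard F = 2) (hE : E ≤ maxUnramified F) {σ₀ : absoluteGaloisGroup F} (hσ₀ : IsAbsArithFrob σ₀)

set_option maxHeartbeats 800000 in
/-- ★★ **De Shalit's Cor. I.2.3 (iv) / Lemma 3.4 (iii) for the whole of `Γ_F`**: for every `σ̃ ∈ Γ_F`,
**`g_{σ̃·β} = (g_β)^{σ̃|_E} ∘ [χ_π(σ̃)]_f`** — the coefficients move by `σ̃|_E` (a power of `φ`), the variable by the Lubin–Tate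
character. [cite: deShalit1987, Ch. I §2.3 (iv), §3.4] -/
theorem relColemanSeries_galAct_eq (β : RelNormCoherentUnits hπ E) (σ : absoluteGaloisGroup F) :
    relColemanSeries hπ E hq hE hσ₀ (β.galAct σ) =
      (PowerSeries.map (frobUnitBall E σ : unitBall E →+* unitBall E) (relColemanSeries hπ E hq hE hσ₀ β)).subst
        (homE hπ E (lubinTateChar hπ σ : 𝒪[F])) := by
  symm
  refine eq_relColemanSeries hπ E hq hE hσ₀ fun m => ?_
  have hψ : ∀ a : LTCoeff F, ((frobUnitBall E σ₀).symm : unitBall E →+* unitBall E) (algebraMap (LTCoeff F) (unitBall E) a) =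
      algebraMap (LTCoeff F) (unitBall E) a := fun a => by
    change (frobUnitBall E σ₀).symm (algebraMap 𝒪[F] (unitBall E) ((LTCoeff.of F).symm a)) = _
    rw [RingEquiv.symm_apply_eq]
    exact (unitBallEquiv_algebraMap E _ _).symm
  rw [map_iterate_subst_homE hπ E hψ, evS_map_subst_homE hπ (le_sup_left : E ≤ E ⊔ ltField π m),
    ← map_frobUnitBall_comm_iterate_symm E hE hσ₀ σ]
  -- `[χ(σ̃)] ω_{m+1} = σ ω_{m+1}`
  have hpt : ltSMul (maxNilIdeal F (E ⊔ ltField π m : IntermediateField F (AlgebraicClosure F))) (isLTRing_LTCoeff hπ)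
      (isLTSeries_LTCoeff π) (LTCoeff.of F (lubinTateChar hπ σ : 𝒪[F]))
      (inclPt (le_sup_right : ltField π m ≤ E ⊔ ltField π m) (cohPt hπ m)) =
      mapPt (relRestrict hπ E m σ) (inclPt (le_sup_right : ltField π m ≤ E ⊔ ltField π m) (cohPt hπ m)) := by
    rw [inclPt_cohPt_eq_relAct, mapPt_relRestrict_relAct, ← relAct, ← relAct_mul]
  rw [hpt, ← map_toUnitBallHom_relRestrict_map_inclUnitBall hπ E σ m, ← algEquiv_evS _ (relRestrict hπ E m σ),
    evS_relColemanSeries]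
  rfl

set_option maxHeartbeats 800000 in
/-- ★ **`δ(σ̃·β) = χ_π(σ̃) · ((δβ)^{σ̃|E} ∘ [χ_π(σ̃)]_f)`** for every `σ̃ ∈ Γ_F`. [cite: deShalit1987, Ch. I §3.4 Lemma (ii)–(iii)] -/
theorem relLogDerivSeries_galAct_eq (β : RelNormCoherentUnits hπ E) (σ : absoluteGaloisGroup F) :
    relLogDerivSeries hπ E hq hE hσ₀ (β.galAct σ) =
      PowerSeries.C (algebraMap 𝒪[F] (unitBall E) (lubinTateChar hπ σ : 𝒪[F])) *
        (PowerSeries.map (frobUnitBall E σ : unitBall E →+* unitBall E) (relLogDerivSeries hπ E hq hE hσ₀ β)).subst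
          (homE hπ E (lubinTateChar hπ σ : 𝒪[F])) := by
  have hψ : ∀ a : LTCoeff F, (frobUnitBall E σ : unitBall E →+* unitBall E) (algebraMap (LTCoeff F) (unitBall E) a) =
      algebraMap (LTCoeff F) (unitBall E) a := frobUnitBall_algebraMap_LTCoeff E σ
  have h1 : relLogDerivSeries hπ E hq hE hσ₀ (β.galAct σ) =
      PowerSeries.C (algebraMap 𝒪[F] (unitBall E) (lubinTateChar hπ σ : 𝒪[F])) *
        (relLogDeriv hπ E (Units.map (PowerSeries.map (frobUnitBall E σ : unitBall E →+* unitBall E)).toMonoidHom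
          (isUnit_relColemanSeries hπ E hq hE hσ₀ β).unit)).subst (homE hπ E (lubinTateChar hπ σ : 𝒪[F])) :=
    relLogDeriv_eq_of_eq_subst_homE hπ E _ _ _ (by
      rw [IsUnit.unit_spec, Units.coe_map, IsUnit.unit_spec, relColemanSeries_galAct_eq hπ E hq hE hσ₀ β σ]; rfl)
  rw [h1, relLogDeriv_map hπ hψ]
  rfl

set_option maxHeartbeats 1600000 in
/-- ★★ **The action of all of `Γ_F` on the coordinates**: for every `σ̃ ∈ Γ_F`,
**`r_{σ̃·β} = χ_π(σ̃) · ι ρ_{χ_π(σ̃)} · ((r_β)^{σ̃|E} ∘ [χ_π(σ̃)]_f)`** (`π = 2u`, `ρ_v` the unit series with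
`(1 + u⁻¹X)(ρ_v ∘ f) = 1 + u⁻¹[v]_f`) — the semilinear action of `Gal(E·K_π^∞/F)` on the free rank-one coordinate module `𝒪_E⟦Y⟧`
making `β ↦ r_β` equivariant (de Shalit's extension of `i` from `G` to `𝒢`, in coordinates). [cite: deShalit1987, Ch. I §3.4, §3.7] -/
theorem relUnitCoordTwo_galAct_eq (u : (LTCoeff F)ˣ) (hu : LTCoeff.of F π = residueFieldCard F * u)
    (β : RelNormCoherentUnits hπ E) (σ : absoluteGaloisGroup F) :
    relUnitCoordTwo hπ E hq hE hσ₀ u hu (β.galAct σ) =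
      PowerSeries.C (algebraMap 𝒪[F] (unitBall E) (lubinTateChar hπ σ : 𝒪[F])) *
        (evenPartTwo hπ hq (unitTwistSerTwo hπ (↑u⁻¹ : LTCoeff F) (lubinTateChar hπ σ))).map
          (algebraMap (LTCoeff F) (unitBall E)) *
        (PowerSeries.map (frobUnitBall E σ : unitBall E →+* unitBall E) (relUnitCoordTwo hπ E hq hE hσ₀ u hu β)).subst
          (homE hπ E (lubinTateChar hπ σ : 𝒪[F])) := by
  have ht := two_eq_of_mul_inv hq u hu
  have hsv := hasSubst_homE hπ E (lubinTateChar hπ σ : 𝒪[F])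
  have hsf : PowerSeries.HasSubst ((ltSer F π).map (algebraMap (LTCoeff F) (unitBall E))) := hasSubst_map_ltSer E
  have hψa : ∀ a : LTCoeff F, (frobUnitBall E σ : unitBall E →+* unitBall E) (algebraMap (LTCoeff F) (unitBall E) a) =
      algebraMap (LTCoeff F) (unitBall E) a := frobUnitBall_algebraMap_LTCoeff E σ
  -- the tilde of `σ̃β`
  have htilde : relTildeSeries hπ E hq hE hσ₀ (u : LTCoeff F) (β.galAct σ) =
      PowerSeries.C (algebraMap 𝒪[F] (unitBall E) (lubinTateChar hπ σ : 𝒪[F])) *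
        (PowerSeries.map (frobUnitBall E σ : unitBall E →+* unitBall E)
          (relTildeSeries hπ E hq hE hσ₀ (u : LTCoeff F) β)).subst (homE hπ E (lubinTateChar hπ σ : 𝒪[F])) := by
    rw [relTildeSeries, relTildeSeries, relLogDerivSeries_galAct_eq hπ E hq hE hσ₀ β σ,
      map_mul (PowerSeries.map (frobUnitBall E σ₀ : unitBall E →+* unitBall E)), PowerSeries.map_C, frobUnitBall_algebraMap E σ₀,
      map_subst_homE hπ (frobUnitBall_algebraMap_LTCoeff E σ₀), ← map_frobUnitBall_comm E hE hσ₀ σ,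
      PowerSeries.subst_mul hsf, subst_map_ltSer_C, ← subst_homE_subst_map_ltSer hπ E,
      map_sub (PowerSeries.map (frobUnitBall E σ : unitBall E →+* unitBall E)),
      map_mul (PowerSeries.map (frobUnitBall E σ : unitBall E →+* unitBall E)), PowerSeries.map_C, hψa,
      ringHom_map_subst_map_ltSer (ψ := (frobUnitBall E σ : unitBall E →+* unitBall E)) (frobUnitBall_algebraMap_pi E σ),
      PowerSeries.subst_sub hsv, PowerSeries.subst_mul hsv, subst_homE_C]
    ring
  symm
  refine eq_relUnitCoordTwo hπ E hq hE hσ₀ u hu _ ?_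
  rw [htilde, relTildeSeries_eq_relUnitCoordTwo hπ E hq hE hσ₀ u hu β,
    map_mul (PowerSeries.map (frobUnitBall E σ : unitBall E →+* unitBall E)),
    map_add (PowerSeries.map (frobUnitBall E σ : unitBall E →+* unitBall E)), map_one,
    map_mul (PowerSeries.map (frobUnitBall E σ : unitBall E →+* unitBall E)), PowerSeries.map_C, hψa, PowerSeries.map_X,
    ringHom_map_subst_map_ltSer (ψ := (frobUnitBall E σ : unitBall E →+* unitBall E)) (frobUnitBall_algebraMap_pi E σ),
    PowerSeries.subst_mul hsv, PowerSeries.subst_add hsv, PowerSeries.subst_mul hsv, subst_homE_C,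
    PowerSeries.subst_X hsv, ← PowerSeries.coe_substAlgHom hsv, map_one, PowerSeries.coe_substAlgHom,
    subst_homE_subst_map_ltSer hπ E, ← one_add_mul_subst_map_evenPartTwo_unitTwistSerTwo hπ E hq ht (lubinTateChar hπ σ),
    PowerSeries.subst_mul hsf, PowerSeries.subst_mul hsf, subst_map_ltSer_C]
  ring

end RelativeGaloisGeneralTwo

end Literature.NumberTheory.GaloisRepresentations
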